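import Mathlib
import Summits.AtomisticToContinuum.FouriersLaw.Theses.EmbeddedDrudeMourre
import HarnessLib

/-!
# Local Morse–Bott floors for a product `Ω = −A·S₁·S₂`: the pointwise algebra
(crux `EmbeddedDrudeMourre.DrudeDissolution`, item stmt-AtomisticToContinuum-12593; `--supports` file for the
registered sub-goal `floorAlg_triple` of stub B1b″ `stub_excursionSecondDifference` of line
`kinetic-polymer-gas-on-the-time-axis`; closes nothing; lead c13 (process B), 2026-08-17)

WHAT. The pointwise algebra behind the gradient floor (C4) of the sup-norm route. For functions
`A S₁ S₂ a₁ a₂ a₃ c₁ c₂` on a topological space, continuous at `p₀`, put (the three partials of `Ω = −A S₁ S₂` in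
the frame `(1,0,0), (0,0,1), (0,1,0)` have exactly this shape, `aᵢ = ∂ᵢA`, `cᵢ = ½cos uᵢ`)
`P₁ = −a₁S₁S₂ + A c₁ S₂`, `P₂ = −a₂S₁S₂ + A S₁ c₂`, `P₃ = −a₃S₁S₂ − A c₁ S₂ − A S₁ c₂`,
`μ = A²S₁² + A²S₂² + S₁²S₂²`. The companion file turns each of the following POINTWISE inequalities (valid
when the data are close to their values at a base point) into `∃ c > 0, ∀ᶠ p in 𝓝 p₀, c·μ ≤ P₁² + P₂² (+ P₃²)`:
* `floorAlg_curve` (near a co-moving curve `S₁ = A = 0`, `S₂ ≈ σ ≠ 0`, transversality `a₂ ≈ α ≠ 0`,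
  `c₁ ≈ κ ≠ 0`); the other curve is the same lemma with the indices swapped;
* `floorAlg_diag` (near the diagonal `S₁ = S₂ = 0`, `A ≈ A₀ ≠ 0`, `cᵢ ≈ κᵢ ≠ 0`);
* `floorAlg_triple` (registered; near a triple point: `a₁+a₂+a₃ ≈ β ≠ 0`, `cᵢ ≈ κᵢ ≠ 0`), using
  `(P₁+P₂+P₃)² = (a₁+a₂+a₃)²S₁²S₂² ≤ 3(P₁²+P₃²+P₂²)` and a pointwise dichotomy for `A²Sᵢ²`.

WHY (role). Item (C4) of the remaining concrete work for B1b″: combined with the classification of the critical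
set (`resonanceFn_criticalSet`), the plane/diagonal transversality (`sheetFn_plane_deriv_snd_ne_zero`,
`sheetFn_diag_deriv_ne_zero`) and compactness, these give `D ≥ c·μ` off the corner balls.
-/

noncomputable section

open scoped Topology
open Filter

namespace Summit.AtomisticToContinuum.FouriersLaw.Theorems.DrudeDissolution.KineticPolymerGasOnTheTimeAxis

/-! ### Pointwise algebra -/

/-- `|x| − |y| ≤ |x − y|`-type floor: `|y − x| ≤ θ` gives `|x| − θ ≤ |y|`. [folklore] -/
theorem abs_ge_of_abs_sub_le {x y θ : ℝ} (h : |y - x| ≤ θ) : |x| - θ ≤ |y| := by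
  have := abs_sub_abs_le_abs_sub x y
  rw [abs_sub_comm] at this
  linarith

/-- **Curve algebra** (see the module docstring). [folklore] -/
theorem floorAlg_curve {A S₁ S₂ a₁ a₂ c₁ c₂ σ α κ γ γ₂ t : ℝ} (hγ : 1 ≤ γ) (hγ₂ : 1 ≤ γ₂)
    (hS₁ : |S₁| ≤ 1) (hS₂1 : |S₂| ≤ 1) (hS₂ : |S₂ - σ| ≤ |σ| / 2) (ha₂ : |a₂ - α| ≤ |α| / 4)
    (hc₁ : |c₁ - κ| ≤ |κ| / 2) (ha₁ : |a₁| ≤ γ) (hc₂ : |c₂| ≤ γ₂) (hA : |A| ≤ |α| * |σ| / (8 * γ₂))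
    (ht0 : 0 < t) (ht1 : t ≤ 1) (ht2 : 8 * γ ^ 2 * t ≤ α ^ 2) :
    σ ^ 2 * min (t * κ ^ 2) (α ^ 2) / 64 * (A ^ 2 * S₁ ^ 2 + A ^ 2 * S₂ ^ 2 + S₁ ^ 2 * S₂ ^ 2) ≤
      (-(a₁ * S₁ * S₂) + A * c₁ * S₂) ^ 2 + (-(a₂ * S₁ * S₂) + A * S₁ * c₂) ^ 2 := by
  have hγ0 : 0 < γ := by linarith
  have hγ₂0 : 0 < γ₂ := by linarith
  -- lower bounds near `p₀`
  have lS₂ : |σ| / 2 ≤ |S₂| := by have := abs_ge_of_abs_sub_le hS₂; linarith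
  have la₂ : 3 * |α| / 4 ≤ |a₂| := by have := abs_ge_of_abs_sub_le ha₂; linarith
  have lc₁ : |κ| / 2 ≤ |c₁| := by have := abs_ge_of_abs_sub_le hc₁; linarith
  have hσ0 : 0 ≤ |σ| := abs_nonneg _
  have hα0 : 0 ≤ |α| := abs_nonneg _
  have hκ0 : 0 ≤ |κ| := abs_nonneg _
  -- (4) `|A c₂ − a₂ S₂| ≥ |α||σ|/4`, hence `P₂² ≥ S₁² α²σ²/16`
  have h4a : 3 * |α| / 4 * (|σ| / 2) ≤ |a₂ * S₂| := by
    rw [abs_mul]; exact mul_le_mul la₂ lS₂ (by positivity) (abs_nonneg _)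
  have h4b : |A * c₂| ≤ |α| * |σ| / 8 := by
    rw [abs_mul]
    calc |A| * |c₂| ≤ |α| * |σ| / (8 * γ₂) * γ₂ := mul_le_mul hA hc₂ (abs_nonneg _) (by positivity)
      _ = |α| * |σ| / 8 := by field_simp
  have h4c : |α| * |σ| / 4 ≤ |A * c₂ - a₂ * S₂| := by
    have := abs_sub_abs_le_abs_sub (a₂ * S₂) (A * c₂)
    rw [abs_sub_comm] at this
    linarith
  have hP₂ : S₁ ^ 2 * (α ^ 2 * σ ^ 2 / 16) ≤ (-(a₂ * S₁ * S₂) + A * S₁ * c₂) ^ 2 := by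
    have e : (-(a₂ * S₁ * S₂) + A * S₁ * c₂) ^ 2 = S₁ ^ 2 * (A * c₂ - a₂ * S₂) ^ 2 := by ring
    rw [e]
    refine mul_le_mul_of_nonneg_left ?_ (sq_nonneg _)
    have h0 : 0 ≤ |α| * |σ| / 4 := by positivity
    have := pow_le_pow_left₀ h0 h4c 2
    rw [sq_abs] at this
    calc α ^ 2 * σ ^ 2 / 16 = (|α| * |σ| / 4) ^ 2 := by rw [div_pow, mul_pow, sq_abs, sq_abs]; ring
      _ ≤ _ := this
  -- (5) `P₁² ≥ σ²κ²A²/32 − σ²γ²S₁²/4`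
  have h5a : σ ^ 2 / 4 ≤ S₂ ^ 2 := by
    have := pow_le_pow_left₀ (by positivity) lS₂ 2
    simp only [sq_abs, div_pow] at this
    norm_num at this
    linarith
  have h5b : A ^ 2 * κ ^ 2 / 4 ≤ (A * c₁) ^ 2 := by
    have h1 : |A| * (|κ| / 2) ≤ |A| * |c₁| := mul_le_mul_of_nonneg_left lc₁ (abs_nonneg _)
    have h2 := pow_le_pow_left₀ (by positivity) h1 2
    rw [← abs_mul, sq_abs, mul_pow, sq_abs, div_pow, sq_abs] at h2
    linarith
  have h5c : (a₁ * S₁) ^ 2 ≤ γ ^ 2 * S₁ ^ 2 := by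
    rw [mul_pow]
    refine mul_le_mul_of_nonneg_right ?_ (sq_nonneg _)
    have := pow_le_pow_left₀ (abs_nonneg _) ha₁ 2
    rwa [sq_abs] at this
  have h5d : (A * c₁) ^ 2 / 2 - (a₁ * S₁) ^ 2 ≤ (A * c₁ - a₁ * S₁) ^ 2 := by
    nlinarith [sq_nonneg (A * c₁ - 2 * (a₁ * S₁))]
  have hP₁ : σ ^ 2 * κ ^ 2 * A ^ 2 / 32 - σ ^ 2 * γ ^ 2 * S₁ ^ 2 / 4 ≤ (-(a₁ * S₁ * S₂) + A * c₁ * S₂) ^ 2 := by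
    have e : (-(a₁ * S₁ * S₂) + A * c₁ * S₂) ^ 2 = S₂ ^ 2 * (A * c₁ - a₁ * S₁) ^ 2 := by ring
    rw [e]
    have hlow : A ^ 2 * κ ^ 2 / 8 - γ ^ 2 * S₁ ^ 2 ≤ (A * c₁ - a₁ * S₁) ^ 2 := by linarith
    -- `σ²/4 ≤ S₂²` and the (possibly negative) lower bound: split on its sign
    by_cases hsgn : 0 ≤ A ^ 2 * κ ^ 2 / 8 - γ ^ 2 * S₁ ^ 2
    · calc σ ^ 2 * κ ^ 2 * A ^ 2 / 32 - σ ^ 2 * γ ^ 2 * S₁ ^ 2 / 4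
            = σ ^ 2 / 4 * (A ^ 2 * κ ^ 2 / 8 - γ ^ 2 * S₁ ^ 2) := by ring
        _ ≤ S₂ ^ 2 * (A * c₁ - a₁ * S₁) ^ 2 := mul_le_mul h5a hlow hsgn (sq_nonneg _)
    · push Not at hsgn
      have : σ ^ 2 * κ ^ 2 * A ^ 2 / 32 - σ ^ 2 * γ ^ 2 * S₁ ^ 2 / 4 =
          σ ^ 2 / 4 * (A ^ 2 * κ ^ 2 / 8 - γ ^ 2 * S₁ ^ 2) := by ring
      rw [this]
      have hn : σ ^ 2 / 4 * (A ^ 2 * κ ^ 2 / 8 - γ ^ 2 * S₁ ^ 2) ≤ 0 :=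
        mul_nonpos_of_nonneg_of_nonpos (by positivity) hsgn.le
      exact hn.trans (by positivity)
  -- (6)–(9) combine
  set m := min (t * κ ^ 2) (α ^ 2) with hm
  have hm1 : m ≤ t * κ ^ 2 := min_le_left _ _
  have hm2 : m ≤ α ^ 2 := min_le_right _ _
  have hm0 : 0 ≤ m := le_min (by positivity) (sq_nonneg _)
  have hμ : A ^ 2 * S₁ ^ 2 + A ^ 2 * S₂ ^ 2 + S₁ ^ 2 * S₂ ^ 2 ≤ 2 * A ^ 2 + S₁ ^ 2 := by
    have s1 : S₁ ^ 2 ≤ 1 := by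
      have := pow_le_pow_left₀ (abs_nonneg _) hS₁ 2; rwa [sq_abs, one_pow] at this
    have s2 : S₂ ^ 2 ≤ 1 := by
      have := pow_le_pow_left₀ (abs_nonneg _) hS₂1 2; rwa [sq_abs, one_pow] at this
    have h1 := mul_le_mul_of_nonneg_left s1 (sq_nonneg A)
    have h2 := mul_le_mul_of_nonneg_left s2 (sq_nonneg A)
    have h3 := mul_le_mul_of_nonneg_left s2 (sq_nonneg S₁)
    linarith
  have hP₁0 : 0 ≤ (-(a₁ * S₁ * S₂) + A * c₁ * S₂) ^ 2 := sq_nonneg _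
  -- `t P₁² + P₂² ≥ tσ²κ²A²/32 + σ²α²S₁²/32`
  have key : t * (σ ^ 2 * κ ^ 2 * A ^ 2 / 32) + σ ^ 2 * α ^ 2 * S₁ ^ 2 / 32 ≤
      t * (-(a₁ * S₁ * S₂) + A * c₁ * S₂) ^ 2 + (-(a₂ * S₁ * S₂) + A * S₁ * c₂) ^ 2 := by
    have h1 := mul_le_mul_of_nonneg_left hP₁ ht0.le
    have h2 : t * (σ ^ 2 * γ ^ 2 * S₁ ^ 2 / 4) ≤ σ ^ 2 * α ^ 2 * S₁ ^ 2 / 32 := by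
      have := mul_le_mul_of_nonneg_left ht2 (show 0 ≤ σ ^ 2 * S₁ ^ 2 / 32 by positivity)
      linarith
    linarith
  calc σ ^ 2 * m / 64 * (A ^ 2 * S₁ ^ 2 + A ^ 2 * S₂ ^ 2 + S₁ ^ 2 * S₂ ^ 2)
      ≤ σ ^ 2 * m / 64 * (2 * A ^ 2 + S₁ ^ 2) := mul_le_mul_of_nonneg_left hμ (by positivity)
    _ = (σ ^ 2 * A ^ 2 / 32) * m + (σ ^ 2 * S₁ ^ 2 / 64) * m := by ring
    _ ≤ (σ ^ 2 * A ^ 2 / 32) * (t * κ ^ 2) + (σ ^ 2 * S₁ ^ 2 / 64) * α ^ 2 := by gcongr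
    _ ≤ t * (σ ^ 2 * κ ^ 2 * A ^ 2 / 32) + σ ^ 2 * α ^ 2 * S₁ ^ 2 / 32 := by
        have : 0 ≤ σ ^ 2 * α ^ 2 * S₁ ^ 2 / 64 := by positivity
        linarith
    _ ≤ t * (-(a₁ * S₁ * S₂) + A * c₁ * S₂) ^ 2 + (-(a₂ * S₁ * S₂) + A * S₁ * c₂) ^ 2 := key
    _ ≤ _ := by
        have := mul_nonneg (sub_nonneg.2 ht1) hP₁0
        linarith

/-- **Diagonal algebra** (see the module docstring). [folklore] -/
theorem floorAlg_diag {A S₁ S₂ a₁ a₂ c₁ c₂ A₀ κ₁ κ₂ γ : ℝ} (hγ : 1 ≤ γ) (hS₂1 : |S₂| ≤ 1)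
    (hA : |A - A₀| ≤ |A₀| / 2) (hc₁ : |c₁ - κ₁| ≤ |κ₁| / 2) (hc₂ : |c₂ - κ₂| ≤ |κ₂| / 2)
    (ha₁ : |a₁| ≤ γ) (ha₂ : |a₂| ≤ γ) (hs₁ : |S₁| ≤ |A₀| * |κ₁| / (8 * γ)) (hs₂ : |S₂| ≤ |A₀| * |κ₂| / (8 * γ)) :
    min (A₀ ^ 2 * κ₁ ^ 2) (A₀ ^ 2 * κ₂ ^ 2) / (16 * (9 * A₀ ^ 2 + 4)) *
        (A ^ 2 * S₁ ^ 2 + A ^ 2 * S₂ ^ 2 + S₁ ^ 2 * S₂ ^ 2) ≤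
      (-(a₁ * S₁ * S₂) + A * c₁ * S₂) ^ 2 + (-(a₂ * S₁ * S₂) + A * S₁ * c₂) ^ 2 := by
  have hγ0 : 0 < γ := by linarith
  have lA : |A₀| / 2 ≤ |A| := by have := abs_ge_of_abs_sub_le hA; linarith
  have uA : |A| ≤ 3 * |A₀| / 2 := by
    have := abs_sub_abs_le_abs_sub A A₀; linarith
  have lc₁ : |κ₁| / 2 ≤ |c₁| := by have := abs_ge_of_abs_sub_le hc₁; linarith
  have lc₂ : |κ₂| / 2 ≤ |c₂| := by have := abs_ge_of_abs_sub_le hc₂; linarith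
  have hA₀ : 0 ≤ |A₀| := abs_nonneg _
  have hκ₁0 : 0 ≤ |κ₁| := abs_nonneg _
  have hκ₂0 : 0 ≤ |κ₂| := abs_nonneg _
  -- `|A cᵢ − aᵢ Sᵢ| ≥ |A₀||κᵢ|/8`
  have k1 : |A₀| * |κ₁| / 8 ≤ |A * c₁ - a₁ * S₁| := by
    have h1 : |A₀| / 2 * (|κ₁| / 2) ≤ |A * c₁| := by
      rw [abs_mul]; exact mul_le_mul lA lc₁ (by positivity) (abs_nonneg _)
    have h2 : |a₁ * S₁| ≤ |A₀| * |κ₁| / 8 := by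
      rw [abs_mul]
      calc |a₁| * |S₁| ≤ γ * (|A₀| * |κ₁| / (8 * γ)) := mul_le_mul ha₁ hs₁ (abs_nonneg _) hγ0.le
        _ = |A₀| * |κ₁| / 8 := by field_simp
    have := abs_sub_abs_le_abs_sub (A * c₁) (a₁ * S₁)
    linarith
  have k2 : |A₀| * |κ₂| / 8 ≤ |A * c₂ - a₂ * S₂| := by
    have h1 : |A₀| / 2 * (|κ₂| / 2) ≤ |A * c₂| := by
      rw [abs_mul]; exact mul_le_mul lA lc₂ (by positivity) (abs_nonneg _)
    have h2 : |a₂ * S₂| ≤ |A₀| * |κ₂| / 8 := by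
      rw [abs_mul]
      calc |a₂| * |S₂| ≤ γ * (|A₀| * |κ₂| / (8 * γ)) := mul_le_mul ha₂ hs₂ (abs_nonneg _) hγ0.le
        _ = |A₀| * |κ₂| / 8 := by field_simp
    have := abs_sub_abs_le_abs_sub (A * c₂) (a₂ * S₂)
    linarith
  have hP₁ : S₂ ^ 2 * (A₀ ^ 2 * κ₁ ^ 2 / 64) ≤ (-(a₁ * S₁ * S₂) + A * c₁ * S₂) ^ 2 := by
    have e : (-(a₁ * S₁ * S₂) + A * c₁ * S₂) ^ 2 = S₂ ^ 2 * (A * c₁ - a₁ * S₁) ^ 2 := by ring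
    rw [e]
    refine mul_le_mul_of_nonneg_left ?_ (sq_nonneg _)
    have := pow_le_pow_left₀ (by positivity) k1 2
    rw [sq_abs] at this
    calc A₀ ^ 2 * κ₁ ^ 2 / 64 = (|A₀| * |κ₁| / 8) ^ 2 := by rw [div_pow, mul_pow, sq_abs, sq_abs]; ring
      _ ≤ _ := this
  have hP₂ : S₁ ^ 2 * (A₀ ^ 2 * κ₂ ^ 2 / 64) ≤ (-(a₂ * S₁ * S₂) + A * S₁ * c₂) ^ 2 := by
    have e : (-(a₂ * S₁ * S₂) + A * S₁ * c₂) ^ 2 = S₁ ^ 2 * (A * c₂ - a₂ * S₂) ^ 2 := by ring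
    rw [e]
    refine mul_le_mul_of_nonneg_left ?_ (sq_nonneg _)
    have := pow_le_pow_left₀ (by positivity) k2 2
    rw [sq_abs] at this
    calc A₀ ^ 2 * κ₂ ^ 2 / 64 = (|A₀| * |κ₂| / 8) ^ 2 := by rw [div_pow, mul_pow, sq_abs, sq_abs]; ring
      _ ≤ _ := this
  -- `μ ≤ ((9A₀²+4)/4)(S₁²+S₂²)`
  have hA2 : A ^ 2 ≤ 9 * A₀ ^ 2 / 4 := by
    have := pow_le_pow_left₀ (abs_nonneg _) uA 2
    rw [sq_abs, div_pow, mul_pow, sq_abs] at this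
    linarith
  have s2 : S₂ ^ 2 ≤ 1 := by
    have := pow_le_pow_left₀ (abs_nonneg _) hS₂1 2; rwa [sq_abs, one_pow] at this
  have hμ : A ^ 2 * S₁ ^ 2 + A ^ 2 * S₂ ^ 2 + S₁ ^ 2 * S₂ ^ 2 ≤ (9 * A₀ ^ 2 + 4) / 4 * (S₁ ^ 2 + S₂ ^ 2) := by
    have h1 := mul_le_mul_of_nonneg_right hA2 (sq_nonneg S₁)
    have h2 := mul_le_mul_of_nonneg_right hA2 (sq_nonneg S₂)
    have h3 := mul_le_mul_of_nonneg_left s2 (sq_nonneg S₁)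
    have h4 := sq_nonneg S₂
    have h5 := sq_nonneg A₀
    have h6 := mul_nonneg h5 h4
    linarith
  set m := min (A₀ ^ 2 * κ₁ ^ 2) (A₀ ^ 2 * κ₂ ^ 2) with hm
  have hm1 : m ≤ A₀ ^ 2 * κ₁ ^ 2 := min_le_left _ _
  have hm2 : m ≤ A₀ ^ 2 * κ₂ ^ 2 := min_le_right _ _
  have hm0 : 0 ≤ m := le_min (by positivity) (by positivity)
  have hL : 0 < 9 * A₀ ^ 2 + 4 := by positivity
  calc m / (16 * (9 * A₀ ^ 2 + 4)) * (A ^ 2 * S₁ ^ 2 + A ^ 2 * S₂ ^ 2 + S₁ ^ 2 * S₂ ^ 2)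
      ≤ m / (16 * (9 * A₀ ^ 2 + 4)) * ((9 * A₀ ^ 2 + 4) / 4 * (S₁ ^ 2 + S₂ ^ 2)) :=
        mul_le_mul_of_nonneg_left hμ (by positivity)
    _ = S₂ ^ 2 * (m / 64) + S₁ ^ 2 * (m / 64) := by field_simp; ring
    _ ≤ S₂ ^ 2 * (A₀ ^ 2 * κ₁ ^ 2 / 64) + S₁ ^ 2 * (A₀ ^ 2 * κ₂ ^ 2 / 64) := by gcongr
    _ ≤ _ := add_le_add hP₁ hP₂

/-- **Registered sub-goal `floorAlg_triple` of stub B1b″: the triple-point algebra.** With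
`T = (P₁+P₂+P₃)² = (a₁+a₂+a₃)²S₁²S₂²`: `μ ≤ 16P₁²/κ₁² + 16P₂²/κ₂² + K·T` and `T ≤ 3(P₁²+P₃²+P₂²)`. [folklore] -/
theorem floorAlg_triple :
    ∀ (A S₁ S₂ a₁ a₂ a₃ c₁ c₂ β κ₁ κ₂ γ : ℝ), 1 ≤ γ →
    |c₁ - κ₁| ≤ |κ₁| / 2 → |c₂ - κ₂| ≤ |κ₂| / 2 → |a₁| ≤ γ → |a₂| ≤ γ →
    |a₁ + a₂ + a₃ - β| ≤ |β| / 2 → β ≠ 0 → κ₁ ≠ 0 → κ₂ ≠ 0 →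
    A ^ 2 * S₁ ^ 2 + A ^ 2 * S₂ ^ 2 + S₁ ^ 2 * S₂ ^ 2 ≤
      (16 / κ₁ ^ 2 + 16 / κ₂ ^ 2 + 3 * (64 * γ ^ 2 / (κ₁ ^ 2 * β ^ 2) + 64 * γ ^ 2 / (κ₂ ^ 2 * β ^ 2) + 4 / β ^ 2)) *
        ((-(a₁ * S₁ * S₂) + A * c₁ * S₂) ^ 2 + (-(a₃ * S₁ * S₂) - A * c₁ * S₂ - A * S₁ * c₂) ^ 2 +
          (-(a₂ * S₁ * S₂) + A * S₁ * c₂) ^ 2) := by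
  intro A S₁ S₂ a₁ a₂ a₃ c₁ c₂ β κ₁ κ₂ γ hγ hc₁ hc₂ ha₁ ha₂ hβ hβ0 hκ₁ hκ₂
  have hγ0 : 0 < γ := by linarith
  have lc₁ : |κ₁| / 2 ≤ |c₁| := by have := abs_ge_of_abs_sub_le hc₁; linarith
  have lc₂ : |κ₂| / 2 ≤ |c₂| := by have := abs_ge_of_abs_sub_le hc₂; linarith
  have lβ : |β| / 2 ≤ |a₁ + a₂ + a₃| := by have := abs_ge_of_abs_sub_le hβ; linarith
  have hβp : 0 < |β| := abs_pos.2 hβ0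
  have hκ₁p : 0 < κ₁ ^ 2 := by positivity
  have hκ₂p : 0 < κ₂ ^ 2 := by positivity
  have hβ2 : 0 < β ^ 2 := by positivity
  set P₁ := -(a₁ * S₁ * S₂) + A * c₁ * S₂ with hP₁
  set P₂ := -(a₂ * S₁ * S₂) + A * S₁ * c₂ with hP₂
  set P₃ := -(a₃ * S₁ * S₂) - A * c₁ * S₂ - A * S₁ * c₂ with hP₃
  set T := (P₁ + P₂ + P₃) ^ 2 with hT
  have hTe : T = (a₁ + a₂ + a₃) ^ 2 * (S₁ ^ 2 * S₂ ^ 2) := by rw [hT, hP₁, hP₂, hP₃]; ring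
  -- `S₁²S₂² ≤ 4T/β²`
  have hSS : S₁ ^ 2 * S₂ ^ 2 ≤ 4 / β ^ 2 * T := by
    have hb : β ^ 2 / 4 ≤ (a₁ + a₂ + a₃) ^ 2 := by
      have := pow_le_pow_left₀ (by positivity) lβ 2
      rw [sq_abs, div_pow, sq_abs] at this
      linarith
    rw [hTe]
    have h1 : β ^ 2 / 4 * (S₁ ^ 2 * S₂ ^ 2) ≤ (a₁ + a₂ + a₃) ^ 2 * (S₁ ^ 2 * S₂ ^ 2) :=
      mul_le_mul_of_nonneg_right hb (by positivity)
    calc S₁ ^ 2 * S₂ ^ 2 = 4 / β ^ 2 * (β ^ 2 / 4 * (S₁ ^ 2 * S₂ ^ 2)) := by field_simp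
      _ ≤ 4 / β ^ 2 * ((a₁ + a₂ + a₃) ^ 2 * (S₁ ^ 2 * S₂ ^ 2)) := by gcongr
  have hT0 : 0 ≤ T := sq_nonneg _
  -- the dichotomy for `A²S₁²`
  have hAS₁ : A ^ 2 * S₁ ^ 2 ≤ 16 / κ₂ ^ 2 * P₂ ^ 2 + 64 * γ ^ 2 / (κ₂ ^ 2 * β ^ 2) * T := by
    have hAc : |A| * (|κ₂| / 2) ≤ |A * c₂| := by
      rw [abs_mul]; exact mul_le_mul_of_nonneg_left lc₂ (abs_nonneg _)
    by_cases h : 2 * |a₂ * S₂| ≤ |A * c₂|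
    · -- `|A c₂ − a₂ S₂| ≥ |A c₂|/2 ≥ |A||κ₂|/4`
      have h1 : |A| * |κ₂| / 4 ≤ |A * c₂ - a₂ * S₂| := by
        have := abs_sub_abs_le_abs_sub (A * c₂) (a₂ * S₂); linarith
      have h2 := pow_le_pow_left₀ (by positivity) h1 2
      simp only [sq_abs, div_pow, mul_pow] at h2
      have h3 : A ^ 2 * S₁ ^ 2 ≤ 16 / κ₂ ^ 2 * P₂ ^ 2 := by
        have e : P₂ ^ 2 = S₁ ^ 2 * (A * c₂ - a₂ * S₂) ^ 2 := by rw [hP₂]; ring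
        rw [e]
        have h4 : A ^ 2 * S₁ ^ 2 = 16 / κ₂ ^ 2 * (S₁ ^ 2 * (A ^ 2 * κ₂ ^ 2 / 4 ^ 2)) := by field_simp; ring
        rw [h4]
        gcongr
      have : 0 ≤ 64 * γ ^ 2 / (κ₂ ^ 2 * β ^ 2) * T := by positivity
      linarith
    · push Not at h
      -- `|A||κ₂|/2 ≤ |A c₂| < 2|a₂||S₂| ≤ 2γ|S₂|`
      have h1 : |A| * |κ₂| ≤ 4 * γ * |S₂| := by
        have : |a₂ * S₂| ≤ γ * |S₂| := by rw [abs_mul]; exact mul_le_mul_of_nonneg_right ha₂ (abs_nonneg _)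
        linarith
      have h2 := pow_le_pow_left₀ (by positivity) h1 2
      simp only [mul_pow, sq_abs] at h2
      -- `A² κ₂² ≤ 16 γ² S₂²`, so `A²S₁² ≤ 16γ²S₁²S₂²/κ₂² ≤ (64γ²/(κ₂²β²)) T`
      have h3 : A ^ 2 * S₁ ^ 2 ≤ 16 * γ ^ 2 / κ₂ ^ 2 * (S₁ ^ 2 * S₂ ^ 2) := by
        rw [show 16 * γ ^ 2 / κ₂ ^ 2 * (S₁ ^ 2 * S₂ ^ 2) = S₁ ^ 2 * (4 ^ 2 * γ ^ 2 * S₂ ^ 2) / κ₂ ^ 2 by ring]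
        rw [le_div_iff₀ hκ₂p]
        have h5 := mul_le_mul_of_nonneg_left h2 (sq_nonneg S₁)
        linarith
      have h4 : 16 * γ ^ 2 / κ₂ ^ 2 * (S₁ ^ 2 * S₂ ^ 2) ≤ 64 * γ ^ 2 / (κ₂ ^ 2 * β ^ 2) * T := by
        calc 16 * γ ^ 2 / κ₂ ^ 2 * (S₁ ^ 2 * S₂ ^ 2) ≤ 16 * γ ^ 2 / κ₂ ^ 2 * (4 / β ^ 2 * T) := by gcongr
          _ = 64 * γ ^ 2 / (κ₂ ^ 2 * β ^ 2) * T := by field_simp; ring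
      have : 0 ≤ 16 / κ₂ ^ 2 * P₂ ^ 2 := by positivity
      linarith
  -- the dichotomy for `A²S₂²`
  have hAS₂ : A ^ 2 * S₂ ^ 2 ≤ 16 / κ₁ ^ 2 * P₁ ^ 2 + 64 * γ ^ 2 / (κ₁ ^ 2 * β ^ 2) * T := by
    have hAc : |A| * (|κ₁| / 2) ≤ |A * c₁| := by
      rw [abs_mul]; exact mul_le_mul_of_nonneg_left lc₁ (abs_nonneg _)
    by_cases h : 2 * |a₁ * S₁| ≤ |A * c₁|
    · have h1 : |A| * |κ₁| / 4 ≤ |A * c₁ - a₁ * S₁| := by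
        have := abs_sub_abs_le_abs_sub (A * c₁) (a₁ * S₁); linarith
      have h2 := pow_le_pow_left₀ (by positivity) h1 2
      simp only [sq_abs, div_pow, mul_pow] at h2
      have h3 : A ^ 2 * S₂ ^ 2 ≤ 16 / κ₁ ^ 2 * P₁ ^ 2 := by
        have e : P₁ ^ 2 = S₂ ^ 2 * (A * c₁ - a₁ * S₁) ^ 2 := by rw [hP₁]; ring
        rw [e]
        have h4 : A ^ 2 * S₂ ^ 2 = 16 / κ₁ ^ 2 * (S₂ ^ 2 * (A ^ 2 * κ₁ ^ 2 / 4 ^ 2)) := by field_simp; ring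
        rw [h4]
        gcongr
      have : 0 ≤ 64 * γ ^ 2 / (κ₁ ^ 2 * β ^ 2) * T := by positivity
      linarith
    · push Not at h
      have h1 : |A| * |κ₁| ≤ 4 * γ * |S₁| := by
        have : |a₁ * S₁| ≤ γ * |S₁| := by rw [abs_mul]; exact mul_le_mul_of_nonneg_right ha₁ (abs_nonneg _)
        linarith
      have h2 := pow_le_pow_left₀ (by positivity) h1 2
      simp only [mul_pow, sq_abs] at h2
      have h3 : A ^ 2 * S₂ ^ 2 ≤ 16 * γ ^ 2 / κ₁ ^ 2 * (S₁ ^ 2 * S₂ ^ 2) := by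
        rw [show 16 * γ ^ 2 / κ₁ ^ 2 * (S₁ ^ 2 * S₂ ^ 2) = S₂ ^ 2 * (4 ^ 2 * γ ^ 2 * S₁ ^ 2) / κ₁ ^ 2 by ring]
        rw [le_div_iff₀ hκ₁p]
        have h5 := mul_le_mul_of_nonneg_left h2 (sq_nonneg S₂)
        linarith
      have h4 : 16 * γ ^ 2 / κ₁ ^ 2 * (S₁ ^ 2 * S₂ ^ 2) ≤ 64 * γ ^ 2 / (κ₁ ^ 2 * β ^ 2) * T := by
        calc 16 * γ ^ 2 / κ₁ ^ 2 * (S₁ ^ 2 * S₂ ^ 2) ≤ 16 * γ ^ 2 / κ₁ ^ 2 * (4 / β ^ 2 * T) := by gcongr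
          _ = 64 * γ ^ 2 / (κ₁ ^ 2 * β ^ 2) * T := by field_simp; ring
      have : 0 ≤ 16 / κ₁ ^ 2 * P₁ ^ 2 := by positivity
      linarith
  -- combine with `T ≤ 3(P₁² + P₃² + P₂²)`
  have hT3 : T ≤ 3 * (P₁ ^ 2 + P₃ ^ 2 + P₂ ^ 2) := by
    have key : ∀ x y z : ℝ, (x + y + z) ^ 2 ≤ 3 * (x ^ 2 + y ^ 2 + z ^ 2) := fun x y z => by
      have e : 3 * (x ^ 2 + y ^ 2 + z ^ 2) - (x + y + z) ^ 2 = (x - y) ^ 2 + (y - z) ^ 2 + (x - z) ^ 2 := by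
        ring
      have h : 0 ≤ (x - y) ^ 2 + (y - z) ^ 2 + (x - z) ^ 2 := by positivity
      rw [← e] at h
      linarith
    rw [hT]; have := key P₁ P₂ P₃; linarith
  have hK0 : 0 ≤ 64 * γ ^ 2 / (κ₁ ^ 2 * β ^ 2) + 64 * γ ^ 2 / (κ₂ ^ 2 * β ^ 2) + 4 / β ^ 2 := by positivity
  have hP₁0 := sq_nonneg P₁
  have hP₂0 := sq_nonneg P₂
  have hP₃0 := sq_nonneg P₃
  have e1 : 16 / κ₁ ^ 2 * P₁ ^ 2 ≤ 16 / κ₁ ^ 2 * (P₁ ^ 2 + P₃ ^ 2 + P₂ ^ 2) :=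
    mul_le_mul_of_nonneg_left (by linarith) (by positivity)
  have e2 : 16 / κ₂ ^ 2 * P₂ ^ 2 ≤ 16 / κ₂ ^ 2 * (P₁ ^ 2 + P₃ ^ 2 + P₂ ^ 2) :=
    mul_le_mul_of_nonneg_left (by linarith) (by positivity)
  have e3 := mul_le_mul_of_nonneg_left hT3 hK0
  have etot : A ^ 2 * S₁ ^ 2 + A ^ 2 * S₂ ^ 2 + S₁ ^ 2 * S₂ ^ 2 ≤
      16 / κ₁ ^ 2 * P₁ ^ 2 + 16 / κ₂ ^ 2 * P₂ ^ 2 +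
        (64 * γ ^ 2 / (κ₁ ^ 2 * β ^ 2) + 64 * γ ^ 2 / (κ₂ ^ 2 * β ^ 2) + 4 / β ^ 2) * T := by
    linarith [hAS₁, hAS₂, hSS]
  calc A ^ 2 * S₁ ^ 2 + A ^ 2 * S₂ ^ 2 + S₁ ^ 2 * S₂ ^ 2
      ≤ 16 / κ₁ ^ 2 * P₁ ^ 2 + 16 / κ₂ ^ 2 * P₂ ^ 2 +
        (64 * γ ^ 2 / (κ₁ ^ 2 * β ^ 2) + 64 * γ ^ 2 / (κ₂ ^ 2 * β ^ 2) + 4 / β ^ 2) * T := etot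
    _ ≤ 16 / κ₁ ^ 2 * (P₁ ^ 2 + P₃ ^ 2 + P₂ ^ 2) + 16 / κ₂ ^ 2 * (P₁ ^ 2 + P₃ ^ 2 + P₂ ^ 2) +
        (64 * γ ^ 2 / (κ₁ ^ 2 * β ^ 2) + 64 * γ ^ 2 / (κ₂ ^ 2 * β ^ 2) + 4 / β ^ 2) *
          (3 * (P₁ ^ 2 + P₃ ^ 2 + P₂ ^ 2)) := add_le_add (add_le_add e1 e2) e3
    _ = _ := by ring

end Summit.AtomisticToContinuum.FouriersLaw.Theorems.DrudeDissolution.KineticPolymerGasOnTheTimeAxis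

end
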